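import Summits.FinalStateConjecture.FinalStateConjecture.Theses.ExactKerrEnds
import Summits.FinalStateConjecture.FinalStateConjecture.Theses.TangentProfileCensorship
import Summits.FinalStateConjecture.FinalStateConjecture.Theses.CurvatureOrSymmetry
import Summits.FinalStateConjecture.FinalStateConjecture.Theorems.ExactKerrEndsCensorshipAlongKerrEndsDefs
import Summits.FinalStateConjecture.FinalStateConjecture.Theorems.ExactKerrEndsCensorshipAlongKerrEndsWindowUpgrade
import Summits.FinalStateConjecture.FinalStateConjecture.Theorems.ExactKerrEndsCensorshipAlongKerrEndsSettledBreathing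
import Summits.FinalStateConjecture.FinalStateConjecture.Theorems.ExactKerrEndsCensorshipAlongKerrEndsRecedingSelection
import Summits.FinalStateConjecture.FinalStateConjecture.Theorems.ExactKerrEndsSettlingAlongCensoredKerrEndsShape
import Summits.FinalStateConjecture.FinalStateConjecture.Theorems.ExactKerrEndsTameEscapeToKerrEndsChartKerrEnd
import Summits.FinalStateConjecture.FinalStateConjecture.Theorems.ExactKerrEndsTameEscapeToKerrEndsMinkowskiLeaf
import Summits.FinalStateConjecture.FinalStateConjecture.Theorems.ExactKerrEndsCensorshipAlongKerrEndsMinkowskiCensored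
import Summits.FinalStateConjecture.FinalStateConjecture.Theorems.SwallowTheDatumTargetGlue
import HarnessLib

/-!
# Route `ExactKerrEnds`, crux `CensorshipAlongKerrEnds` (stmt-FinalStateConjecture-18521), line `Sketch`
# (idea `transplant-the-end`): THE GLUE — the crux from its two open stubs and five route items

This file is the sorry-free COMPOSITION of line `Sketch` (tree skeleton `Cruxes/CensorshipAlongKerrEnds/Lines/Sketch.lean`,
v3.5), landed as the registered sub-goal `censorshipAlongKerrEnds_of_stubs` of the crux item:

  `GluingAlongFamily → ReEndingAbsorption → MGHDExists → NakedDataTameExit → TameCensoredDataExit →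
     AdmissibleMassNonneg → ZeroMassAdmissibleMinkowskian → CensorshipAlongKerrEnds`,

where the last SIX names are route items BY NAME (stmt-9937, stmt-17383, stmt-17348, stmt-18051, stmt-18053 and the
crux stmt-18521) and the first two hypotheses are the two OPEN registered stubs of the line, stated over the
route-posited predicates of `…CensorshipAlongKerrEndsDefs.lean` (`GluedStructure`, `IsChartExactKerrBeyond`,
`JointConvergence`, `UniformBound`, `EventuallyOnBands`):

* CORE `stub_gluingAlongFamily` (XL, analytic) — matched exterior Kerr gluing ALONG a tame family `G` of admissible
  data with positive base mass: a glued two-parameter family `H c R`, jointly smooth, `= G c` off `e.far R`,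
  admissible, DR-flat, chart-exact Kerr beyond `4R`, `wDist (H c R) (G c) → 0` pointwise and jointly at `(0, ∞)`,
  uniformly bounded (Corvino–Schoen 2006 Thm 4 / Mao–Oh–Tao 2023 Thm 1.3 run along a smooth two-parameter input;
  the parametric solution map is unprinted);
* PHYSICS `stub_reEndingAbsorption` (open) — along such a glued family over a tame family with SETTLED members off
  `0`, the re-ended members are CENSORED on compact parameter bands for all large radii (asymptotic stability of
  settled developments under re-ending of the far field).

Proof (§3): settled tame access `G` through the base `F 0` (MGHD existence + the two exits + the landed
`stub_settledBreathing`); read off the continuous DR mass `M` of `G`.  If `M 0 ≤ 0`, the two positive-mass ITEMS make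
the base Minkowskian (`0 ≤ M 0`, then a Cauchy development which IS Minkowski space), hence Kerr-ended
(`hasExactKerrEnd_of_cauchyDevelopment_eq_minkowski`) and censored (`censored_of_cauchyDevelopment_eq_minkowski`), and
its breathing curve (`kerrEndedCensoredSelfWitness`) is the answer.  If `M 0 > 0`: glue along `G` (core), obtain
censoredness of the glued members on compact bands (physics), Kerr-endedness from chart-exactness (`chartKerrEnd`),
select a smooth receding radius (landed `stub_recedingSelection`) and upgrade the punctured window (landed
`stub_windowUpgrade`).  No definitions, no named facts; Mathlib + the Literature cone + landed Theorems only.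
References: Christodoulou, CQG 16 (1999) A23, p. A24; Corvino–Schoen, JDG 73 (2006), Thm. 4; Beig–Chruściel,
J. Math. Phys. 37 (1996), Thm. 4.1.
-/

-- the summit-side namespace `Summit.FinalStateConjecture.FinalStateConjecture.…` (summit = problem)
-- doubles the `FinalStateConjecture` path component by design; `dupNamespace` would flag every decl.
set_option linter.dupNamespace false

noncomputable section

open scoped Manifold ContDiff Topology ENNReal
open Set Function Filter TopologicalSpace Literature.Geometry.Lorentzian
open Summit.FinalStateConjecture.FinalStateConjecture.Theses.ExactKerrEnds
  (CensorshipAlongKerrEnds MGHDExists AdmissibleMassNonneg ZeroMassAdmissibleMinkowskian)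
open Summit.FinalStateConjecture.FinalStateConjecture.Theses.TangentProfileCensorship (NakedDataTameExit)
open Summit.FinalStateConjecture.FinalStateConjecture.Theses.CurvatureOrSymmetry (TameCensoredDataExit)
open Summit.FinalStateConjecture.FinalStateConjecture.Theorems.SwallowTheDatum.ParametricKerrBurial
  (SmoothSectionsOn AgreeAt)

namespace Summit.FinalStateConjecture.FinalStateConjecture.Theorems.ExactKerrEnds

/-! ## §1 Small API of the glued-family predicates -/
section API

variable {X : Type} [TopologicalSpace X] [ChartedSpace E3 X] [IsManifold (𝓡 3) ∞ X]

/-- Restricting the structural clauses of a glued family to a smaller parameter ball. [folklore] -/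
theorem GluedStructure.mono {e : AFEnd X} {G : EuclideanSpace ℝ (Fin 1) → InitialDataSet (𝓡 3) X}
    {ε ε' Rstar : ℝ} {m : EuclideanSpace ℝ (Fin 1) → ℝ → ℝ}
    {H : EuclideanSpace ℝ (Fin 1) → ℝ → InitialDataSet (𝓡 3) X}
    (h : GluedStructure e G ε Rstar m H) (hε' : ε' ≤ ε) : GluedStructure e G ε' Rstar m H := by
  obtain ⟨hm, hH, hmem⟩ := h
  refine ⟨hm.mono fun q hq ↦ ⟨lt_of_lt_of_le hq.1 hε', hq.2⟩,
    ⟨hH.1.mono fun p hp ↦ ⟨lt_of_lt_of_le hp.1 hε', hp.2⟩, hH.2.mono fun p hp ↦ ⟨lt_of_lt_of_le hp.1 hε', hp.2⟩⟩,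
    fun c R hc hR ↦ hmem c R (lt_of_lt_of_le hc hε') hR⟩

/-- Re-basing joint convergence on another (positive) parameter radius: the clause only shrinks `ε₁`. [folklore] -/
theorem JointConvergence.mono {e : AFEnd X} {G : EuclideanSpace ℝ (Fin 1) → InitialDataSet (𝓡 3) X}
    {Mf : EuclideanSpace ℝ (Fin 1) → ℝ} {ε ε' Rstar : ℝ} {m : EuclideanSpace ℝ (Fin 1) → ℝ → ℝ}
    {H : EuclideanSpace ℝ (Fin 1) → ℝ → InitialDataSet (𝓡 3) X}
    (h : JointConvergence e G Mf ε Rstar m H) (hε'pos : 0 < ε') : JointConvergence e G Mf ε' Rstar m H := by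
  intro η hη
  obtain ⟨ε₁, R₁, hε₁, -, hR₁, hcl⟩ := h η hη
  exact ⟨min ε₁ ε', R₁, lt_min hε₁ hε'pos, min_le_right _ _, hR₁,
    fun c R hc hR ↦ hcl c R (lt_of_lt_of_le hc (min_le_left _ _)) hR⟩

/-- Restricting a uniform weighted bound to a smaller parameter ball. [folklore] -/
theorem UniformBound.mono {e : AFEnd X} {G : EuclideanSpace ℝ (Fin 1) → InitialDataSet (𝓡 3) X}
    {ε ε' Rstar : ℝ} {H : EuclideanSpace ℝ (Fin 1) → ℝ → InitialDataSet (𝓡 3) X}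
    (h : UniformBound e G ε Rstar H) (hε' : ε' ≤ ε) : UniformBound e G ε' Rstar H := by
  obtain ⟨B, hB⟩ := h
  exact ⟨B, fun c R hc hR ↦ hB c R (lt_of_lt_of_le hc hε') hR⟩

variable [T2Space X] [SecondCountableTopology X] [ConnectedSpace X]

-- the conclusion `D.HasExactKerrEnd` hides a second `[Kerr.Facts]` binder (the notion's own guard); both are needed
-- syntactically (the hypothesis mentions `Kerr.smoothMetric`), and `Kerr.Facts` is a `Prop`
set_option linter.overlappingInstances false in
/-- **Chart-exactness beyond `4R` on a sole end makes the datum Kerr-ended** (the sibling crux's landed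
`chartKerrEnd`, S3a, whose hypothesis IS `IsChartExactKerrBeyond` unfolded). [folklore] -/
theorem hasExactKerrEnd_of_isChartExactKerrBeyond_four_mul [Kerr.Facts] {e : AFEnd X} {D : InitialDataSet (𝓡 3) X}
    {Rstar R : ℝ} (hsole : e.IsSoleEnd) (hRstar : e.R < Rstar) (hR : Rstar < R)
    (h : IsChartExactKerrBeyond e D (4 * R)) : D.HasExactKerrEnd :=
  have hpos : 0 < R := lt_trans e.R_pos (lt_trans hRstar hR)
  chartKerrEnd X e D (4 * R) hsole (by linarith) h

/-- **The mass branch from the two route items**: a non-positive DR mass on a sole end of an admissible datum is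
zero (`AdmissibleMassNonneg`, stmt-18051) and the datum then has a Cauchy development WHICH IS Minkowski space
(`ZeroMassAdmissibleMinkowskian`, stmt-18053). [cite: BeigChrusciel1996, Thm. 4.1] -/
theorem exists_cauchyDevelopment_eq_minkowski_of_items (hA : AdmissibleMassNonneg)
    (hZ : ZeroMassAdmissibleMinkowskian) {d : InitialDataSet (𝓡 3) X} (hd : d ∈ admissibleVacuumData X)
    {e : AFEnd X} {M : ℝ} (hsole : e.IsSoleEnd) (hM : M ≤ 0) (hDR : e.IsStronglyAsymptoticallyFlatDR d M) :
    ∃ 𝒟 : CauchyDevelopment d, 𝒟.toSpacetime = Minkowski.spacetime := by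
  have hM0 : M = 0 := le_antisymm hM (hA X d hd e M hsole hDR)
  subst hM0
  exact hZ X d hd e hsole hDR

end API

/-! ## §2 Settled tame access from the exits -/

namespace CensorshipAlongKerrEnds

/-- **Settled tame access at every admissible datum** from MGHD existence (stmt-9937), the naked-data exit
(stmt-17383), the censored-data exit (stmt-17348) and, at a datum which is already settled, the landed
`stub_settledBreathing` (case split on the base). [cite: Christodoulou1999, p. A24] -/
theorem settledTameAccess_of_exits (hM : MGHDExists) (hN : NakedDataTameExit) (hT : TameCensoredDataExit) :
    ∀ (X : Type) [TopologicalSpace X] [ChartedSpace E3 X] [IsManifold (𝓡 3) ∞ X] [T2Space X]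
      [SecondCountableTopology X] [ConnectedSpace X], ∀ d ∈ admissibleVacuumData X,
      ∃ (e : AFEnd X) (G : EuclideanSpace ℝ (Fin 1) → InitialDataSet (𝓡 3) X),
        InitialDataSet.IsTameDataFamily e 1 G ∧ InitialDataSet.IsImmersedAtZero 1 G ∧ G 0 = d ∧
          (∀ c, G c ∈ admissibleVacuumData X) ∧
            ∃ ε > (0 : ℝ), ∀ c, c ≠ 0 → ‖c‖ < ε →
              (∃ 𝒟 : VacuumCauchyDevelopment (G c), 𝒟.IsMaximal) ∧
                ∀ 𝒟 : VacuumCauchyDevelopment (G c), 𝒟.IsMaximal →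
                  HasCompleteNullInfinity 𝒟.toCauchyDevelopment ∧
                    ∃ (O : Set 𝒟.carrier) (dd : FinalStateDecomposition 𝒟.toSpacetime O 2),
                      (∀ i, Kerr.IsSubextremal (dd.mass i) (dd.spin i)) ∧
                        O = exteriorOf 𝒟.toCauchyDevelopment dd.charted ∧
                          RaysStayInClosure 𝒟.toCauchyDevelopment O ∧ HasExhaustiveCharts dd ∧
                            IsFutureOriented dd := by
  intro X _ _ _ _ _ _ d hd
  have hex : ∃ 𝒟 : VacuumCauchyDevelopment d, 𝒟.IsMaximal := hM X d hd
  by_cases hC : ∀ 𝒟 : VacuumCauchyDevelopment d, 𝒟.IsMaximal → HasCompleteNullInfinity 𝒟.toCauchyDevelopment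
  · by_cases hS : ∀ 𝒟 : VacuumCauchyDevelopment d, 𝒟.IsMaximal →
        ∃ (O : Set 𝒟.carrier) (dd : FinalStateDecomposition 𝒟.toSpacetime O 2),
          (∀ i, Kerr.IsSubextremal (dd.mass i) (dd.spin i)) ∧
            O = exteriorOf 𝒟.toCauchyDevelopment dd.charted ∧
              RaysStayInClosure 𝒟.toCauchyDevelopment O ∧ HasExhaustiveCharts dd ∧ IsFutureOriented dd
    · obtain ⟨e, G, hGt, hGi, hG0, hGadm, hGs⟩ :=
        stub_settledBreathing X d hd ⟨hex, fun 𝒟 h𝒟 ↦ ⟨hC 𝒟 h𝒟, hS 𝒟 h𝒟⟩⟩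
      exact ⟨e, G, hGt, hGi, hG0, hGadm, 1, one_pos, fun c _ _ ↦ hGs c⟩
    · push Not at hS
      obtain ⟨𝒟, h𝒟, hno⟩ := hS
      obtain ⟨e, F, hFt, hFi, hF0, -, hFadm, ε, hε, hgood⟩ :=
        hT X d hd hex hC ⟨𝒟, h𝒟, fun ⟨O, dd, h1, h2, h3, h4, h5⟩ ↦ hno O dd h1 h2 h3 h4 h5⟩
      exact ⟨e, F, hFt, hFi, hF0, hFadm, ε, hε, fun c hc hcε ↦ hgood c hc hcε⟩
  · push Not at hC
    obtain ⟨𝒟, h𝒟, hno⟩ := hC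
    obtain ⟨e, F, hFt, hFi, hF0, -, hFadm, ε, hε, hgood⟩ := hN X d hd ⟨𝒟, h𝒟, hno⟩
    exact ⟨e, F, hFt, hFi, hF0, hFadm, ε, hε, fun c hc hcε ↦ hgood c hc hcε⟩

/-! ## §3 The registered glue -/

/-- **Registered sub-goal `censorshipAlongKerrEnds_of_stubs` of the crux item (stmt-FinalStateConjecture-18521) —
the composition of line `Sketch`: `CensorshipAlongKerrEnds` from the core (matched Kerr gluing along a tame family),
the physics (re-ending absorption) and the five route items `MGHDExists`, `NakedDataTameExit`,
`TameCensoredDataExit`, `AdmissibleMassNonneg`, `ZeroMassAdmissibleMinkowskian` BY NAME.** Proof: see the module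
docstring. [cite: Christodoulou1999, p. A24] [cite: CorvinoSchoen2006, Thm. 4] -/
theorem censorshipAlongKerrEnds_of_stubs : (∀ (X : Type) [TopologicalSpace X] [ChartedSpace E3 X] [IsManifold (𝓡 3) ((⊤ : ℕ∞) : WithTop ℕ∞) X] [T2Space X] [SecondCountableTopology X] [ConnectedSpace X], ∀ [Kerr.Facts], ∀ (e : AFEnd X) (G : EuclideanSpace ℝ (Fin 1) → InitialDataSet (𝓡 3) X) (Mf : EuclideanSpace ℝ (Fin 1) → ℝ), InitialDataSet.IsTameDataFamily e 1 G → (∀ c, G c ∈ admissibleVacuumData X) → Continuous Mf → (∀ c, e.IsStronglyAsymptoticallyFlatDR (G c) (Mf c)) → 0 < Mf 0 → ∃ (ε Rstar : ℝ) (m : EuclideanSpace ℝ (Fin 1) → ℝ → ℝ) (H : EuclideanSpace ℝ (Fin 1) → ℝ → InitialDataSet (𝓡 3) X), 0 < ε ∧ e.R < Rstar ∧ GluedStructure e G ε Rstar m H ∧ (∀ (c : EuclideanSpace ℝ (Fin 1)) (R : ℝ), ‖c‖ < ε → Rstar < R → H c R ∈ admissibleVacuumData X ∧ IsChartExactKerrBeyond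 e (H c R) (4 * R)) ∧ (∀ c : EuclideanSpace ℝ (Fin 1), ‖c‖ < ε → Filter.Tendsto (fun R ↦ e.wDist (H c R) (G c)) Filter.atTop (nhds 0)) ∧ JointConvergence e G Mf ε Rstar m H ∧ UniformBound e G ε Rstar H) → (∀ (X : Type) [TopologicalSpace X] [ChartedSpace E3 X] [IsManifold (𝓡 3) ((⊤ : ℕ∞) : WithTop ℕ∞) X] [T2Space X] [SecondCountableTopology X] [ConnectedSpace X], ∀ [Kerr.Facts], ∀ (e : AFEnd X) (G : EuclideanSpace ℝ (Fin 1) → InitialDataSet (𝓡 3) X) (Mf : EuclideanSpace ℝ (Fin 1) → ℝ) (ε Rstar : ℝ) (m : EuclideanSpace ℝ (Fin 1) → ℝ → ℝ) (H : EuclideanSpace ℝ (Fin 1) → ℝ → InitialDataSet (𝓡 3) X), InitialDataSet.IsTameDataFamily e 1 G → (∀ c, G c ∈ admissibleVacuumData X) → Continuous Mf → (∀ c, e.IsStronglyAsymptoticallyFlatDR (G c) (Mf c)) → 0 < ε → e.R < Rstar → (∀ c : EuclideanSpace ℝ (Fin 1), c ≠ 0 → ‖c‖ < ε → (∃ 𝒟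 : VacuumCauchyDevelopment (G c), 𝒟.IsMaximal) ∧ ∀ 𝒟 : VacuumCauchyDevelopment (G c), 𝒟.IsMaximal → HasCompleteNullInfinity 𝒟.toCauchyDevelopment ∧ ∃ (O : Set 𝒟.carrier) (d : FinalStateDecomposition 𝒟.toSpacetime O 2), (∀ i, Kerr.IsSubextremal (d.mass i) (d.spin i)) ∧ O = exteriorOf 𝒟.toCauchyDevelopment d.charted ∧ RaysStayInClosure 𝒟.toCauchyDevelopment O ∧ HasExhaustiveCharts d ∧ IsFutureOriented d) → GluedStructure e G ε Rstar m H → (∀ (c : EuclideanSpace ℝ (Fin 1)) (R : ℝ), ‖c‖ < ε → Rstar < R → H c R ∈ admissibleVacuumData X ∧ IsChartExactKerrBeyond e (H c R) (4 * R)) → (∀ c : EuclideanSpace ℝ (Fin 1), ‖c‖ < ε → Filter.Tendsto (fun R ↦ e.wDist (H c R) (G c)) Filter.atTop (nhds 0)) → JointConvergence e G Mf ε Rstar m H → UniformBound e G ε Rstar H → EventuallyOnBands (fun D ↦ ∀ 𝒟 : VacuumCauchyDevelopment D, 𝒟.IsMaximal → HasCompleteNullInfinity 𝒟.toCauchyDevelopment)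 ε Rstar H) → MGHDExists → NakedDataTameExit → TameCensoredDataExit → AdmissibleMassNonneg → ZeroMassAdmissibleMinkowskian → CensorshipAlongKerrEnds := by
  intro hcore habs hM hN hT hA hZ X _ _ _ _ _ _ KerrEnded' Censored' e F hF hshape hadm hKE
  have hd : F 0 ∈ admissibleVacuumData X := hadm 0
  obtain ⟨e₁, G, hGt, hGi, hG0, hGadm, ε, hε, hGset⟩ := settledTameAccess_of_exits hM hN hT X (F 0) hd
  obtain ⟨Mf, hMf, hDR⟩ := hGt.2.2.1
  have hsole : e₁.IsSoleEnd := hGt.2.1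
  by_cases hpos : 0 < Mf 0
  · -- gluing branch
    haveI : Kerr.Facts := SwallowTheDatum.kerrFacts
    obtain ⟨ε₀, Rstar, m, H, hε₀, hRstar, hstr, hmem, hpt, hjoint, hbd⟩ := hcore X e₁ G Mf hGt hGadm hMf hDR hpos
    set ε₂ : ℝ := min ε ε₀ with hε₂def
    have hε₂ : 0 < ε₂ := lt_min hε hε₀
    have hε₂ε : ε₂ ≤ ε := min_le_left _ _
    have hε₂ε₀ : ε₂ ≤ ε₀ := min_le_right _ _
    have hstr₂ : GluedStructure e₁ G ε₂ Rstar m H := hstr.mono hε₂ε₀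
    have hjoint₂ : JointConvergence e₁ G Mf ε₂ Rstar m H := hjoint.mono hε₂
    have hbd₂ : UniformBound e₁ G ε₂ Rstar H := hbd.mono hε₂ε₀
    have hmem₂ : ∀ (c : EuclideanSpace ℝ (Fin 1)) (R : ℝ), ‖c‖ < ε₂ → Rstar < R →
        H c R ∈ admissibleVacuumData X ∧ IsChartExactKerrBeyond e₁ (H c R) (4 * R) :=
      fun c R hc hR ↦ hmem c R (lt_of_lt_of_le hc hε₂ε₀) hR
    have hpt₂ : ∀ c : EuclideanSpace ℝ (Fin 1), ‖c‖ < ε₂ →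
        Tendsto (fun R ↦ e₁.wDist (H c R) (G c)) atTop (𝓝 0) :=
      fun c hc ↦ hpt c (lt_of_lt_of_le hc hε₂ε₀)
    -- physics: censoredness of the re-ended members on compact bands
    have hcens : EventuallyOnBands
        (fun D ↦ ∀ 𝒟 : VacuumCauchyDevelopment D, 𝒟.IsMaximal → HasCompleteNullInfinity 𝒟.toCauchyDevelopment)
        ε₂ Rstar H :=
      habs X e₁ G Mf ε₂ Rstar m H hGt hGadm hMf hDR hε₂ hRstar
        (fun c hc hcε ↦ hGset c hc (lt_of_lt_of_le hcε hε₂ε)) hstr₂ hmem₂ hpt₂ hjoint₂ hbd₂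
    -- the property to be selected: admissible ∧ Kerr-ended ∧ censored
    have hP : EventuallyOnBands (fun D ↦ D ∈ admissibleVacuumData X ∧ D.HasExactKerrEnd ∧
        ∀ 𝒟 : VacuumCauchyDevelopment D, 𝒟.IsMaximal → HasCompleteNullInfinity 𝒟.toCauchyDevelopment)
        ε₂ Rstar H := by
      intro C hC h0 hCε
      obtain ⟨R₂, hR₂, hR₂P⟩ := hcens C hC h0 hCε
      refine ⟨R₂, hR₂, fun c hc R hR ↦ ?_⟩
      have hcε : ‖c‖ < ε₂ := by simpa using hCε hc
      have hRstarR : Rstar < R := lt_of_le_of_lt hR₂ hR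
      obtain ⟨hadm', hchart⟩ := hmem₂ c R hcε hRstarR
      exact ⟨hadm', hasExactKerrEnd_of_isChartExactKerrBeyond_four_mul hsole hRstar hRstarR hchart, hR₂P c hc R hR⟩
    -- bookkeeping: select a smooth receding radius (landed `stub_recedingSelection`)
    obtain ⟨F', hF't, hF'i, hF'0, ε', hε', hF'P⟩ :=
      stub_recedingSelection X (fun D ↦ D ∈ admissibleVacuumData X ∧ D.HasExactKerrEnd ∧
          ∀ 𝒟 : VacuumCauchyDevelopment D, 𝒟.IsMaximal → HasCompleteNullInfinity 𝒟.toCauchyDevelopment)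
        e₁ G Mf ε₂ Rstar m H hGt hGi hMf hDR hε₂ hRstar hstr₂ hjoint₂ hP
    -- window upgrade (landed `stub_windowUpgrade`)
    obtain ⟨F'', hF''t, hF''0, hF''inj, hF''i, hF''P⟩ :=
      stub_windowUpgrade X (fun D ↦ D ∈ admissibleVacuumData X ∧ D.HasExactKerrEnd ∧
          ∀ 𝒟 : VacuumCauchyDevelopment D, 𝒟.IsMaximal → HasCompleteNullInfinity 𝒟.toCauchyDevelopment)
        e₁ F' hF't hF'i ⟨ε', hε', hF'P⟩
    refine ⟨e₁, F'', hF''t, hF''0.trans (hF'0.trans hG0), hF''inj, hF''i, ?_, ?_⟩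
    · intro c
      by_cases hc : c = 0
      · subst hc
        rw [hF''0, hF'0, hG0]
        exact hd
      · exact (hF''P c hc).1
    · intro c hc
      exact ⟨(hF''P c hc).2.1, (hF''P c hc).2.2⟩
  · -- flat base branch: the base datum is Minkowskian, hence Kerr-ended and censored; breathe it
    have hle : Mf 0 ≤ 0 := not_lt.mp hpos
    obtain ⟨𝒟, h𝒟⟩ := exists_cauchyDevelopment_eq_minkowski_of_items hA hZ (hGadm 0) hsole hle (hDR 0)
    have hKE0 : (F 0).HasExactKerrEnd := by
      rw [← hG0]
      exact hasExactKerrEnd_of_cauchyDevelopment_eq_minkowski X (G 0) e₁ hsole 𝒟 h𝒟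
    have hC0 : ∀ 𝒟' : VacuumCauchyDevelopment (F 0), 𝒟'.IsMaximal →
        HasCompleteNullInfinity 𝒟'.toCauchyDevelopment := by
      rw [← hG0]
      exact censored_of_cauchyDevelopment_eq_minkowski X (G 0) 𝒟 h𝒟
    obtain ⟨e', F', hF't, hF'0, hF'inj, hF'i, hF'adm, hgood⟩ := kerrEndedCensoredSelfWitness hd hKE0 hC0
    exact ⟨e', F', hF't, hF'0, hF'inj, hF'i, hF'adm, fun c _ ↦ ⟨(hgood c).1, (hgood c).2⟩⟩

end CensorshipAlongKerrEnds

end Summit.FinalStateConjecture.FinalStateConjecture.Theorems.ExactKerrEnds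

end
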